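import Mathlib
import HarnessLib
import Summits.Langlands.Langlands.Theses.OrdinaryPrimeTransport
import Literature.NumberTheory.Automorphic.Qian2022PotentialAutomorphy

/-!
# Line `residual_dichotomy` for crux stmt-Langlands-17210
`Summit.Langlands.Langlands.Theses.OrdinaryPrimeTransport.SummandsPotentiallyAutomorphic` (strategist `--alt` line)

Route `route-Langlands-OrdinaryPrimeTransport` (rev 13; this crux is `hPA`, rank 2).  The registered line
`birth` cuts the crux as inheritance → ORDINARY POTENTIAL AUTOMORPHY (open core, monolithic: Qian Thm 1.4
minus ALL residual hypotheses, at EVERY ordinary prime) → soluble descent → renormalisation.  The strategy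
census (`STRATEGY-CENSUS.md` of this crux) finds no engine that dodges the open core as a whole, but shows
it is NOT uniformly open: by RESIDUAL TYPE of the summand `σ` at the given prime it splits into

* a CITATION-GRADE sector — `σ` a character (`k = 1`, class field theory), or `σ` QIAN-GOOD over some
  finite Galois CM `K₁/K` (some residual representation `τ` of `σ|_{K₁}` absolutely irreducible and
  decomposed generic, `τ|_{Γ_{K₁(ζ_ℓ₀)}}` absolutely irreducible of enormous image, a scalar `τ(g)` for
  some `g ∉ Γ_{K₁(ζ_ℓ₀)}` — hypotheses (iii)–(iv) of the tree fact
  `Qian2022.potentialAutomorphy_ordinary` VERBATIM over `K₁`): Qian 2023 Thm 1.4 + Moret-Bailly field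
  control (Qian's `F'` is `F · L̃` with `L̃/ℚ` Galois, pp. 21–24 of the held text, hence Galois over the
  totally real base too) + the restriction bookkeeping `(σ|_{K₁})|_{F'} ≃ σ|_{F'}`;
* the DEGENERATE sector — everything else (`σ̄` absolutely reducible, or `σ̄|_{K₁(ζ)}` reducible /
  not enormous over every CM Galois `K₁`, no scalar element, not decomposed generic): NO engine in print
  (residually reducible / inadequate ordinary automorphy lifting for non-polarised `GL_k` over CM fields,
  i.e. Skinner–Wiles in positive defect; nearest: Thorne 2015 / Allen–Newton–Thorne 2020 POLARISED,
  Miagkov–Thorne 2023 ADEQUATE (still absolutely irreducible), Berger–Klosin `GL_2` imaginary quadratic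
  under cyclicity, Pan 2022 `GL_2/ℚ`).

THE CUT (five stubs; composition kernel-checked; stubs 1, 4, 5 are birth's 1, 3, 4 VERBATIM so that registering
this skeleton archives nothing of substance — it is birth with its open stub 2 cut in two):
* `stub_summand_inherits` — verbatim the birth stub (summand inheritance at an ordinary prime; L).
* `stub_potentiallyAutomorphic_big` — ordinary PA with field control in the big-or-abelian sector,
  stated INTRINSICALLY for `σ` (no automorphic origin): citation-grade (L/XL of plumbing, no open math
  beyond the `IsCrystallineOrdinaryAt → IsOrdinaryRegularAt` bridge at the canonical Artin datum).
* `stub_potentiallyAutomorphic_degenerate` — THE OPEN CORE, typed sharply: the crux's own situation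
  (automorphic origin kept: `π`, `ρ₀`, `ρ₁` in the binders) + inheritance conclusions as hypotheses +
  the NEGATION of the big-or-abelian predicate ⟹ Galois CM `F'` with `σ|_{F'}` irreducible and
  Qian-automorphic.
* `stub_solubleDescent_intermediate` — verbatim birth stub 3: soluble descent (ACC+ Prop 6.5.13(2)) of
  Qian-automorphy from `F'` to every intermediate `E` with `Gal(F'/E)` soluble (M/L).
* `stub_satakeCompatible_of_isAutomorphic` — verbatim birth stub 4: renormalisation of Qian-automorphy to the
  summit's Satake–Frobenius clause with some cuspidal `P` a.e. (M).
* `SummandsPotentiallyAutomorphic_of : stub 1 → stub 2 → stub 3 → stub 4 → stub 5 → SummandsPotentiallyAutomorphic`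
  — no `sorry`; all five hypotheses load-bearing (case split on the big-or-abelian predicate).

The same four statements are prepared as a ROUTE-LEVEL SPLIT (children `SummandInheritance`,
`OrdinaryPotentialAutomorphyBig`, `OrdinaryPotentialAutomorphyDegenerate`, `SolubleDescentRenormalise`;
glue `SummandsPotentiallyAutomorphic_of_subs` proved, evidence `Split.lean` on the item; there stubs 4 and 5 are
composed into the single child `SolubleDescentRenormalise`).

Disproof used: none exists (no `Disproof.lean` / `Negative/` for this crux at 2026-08-17; `ledger crux ls`).
Honoured item evidence: refuter `SurvivesProbe.lean` (`Langlands → crux` kernel-checked: the crux is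
summit-implied, so no stub may be refutable unless the summit is; every stub here is TRUE under the
summit — stub 3 by Fontaine–Mazur–Langlands for `σ` + cyclic base change); `ledger negatives --problem
Langlands` (4 entries: SplitPrimeInduction ×2, the rank-0 `GL_0` junk of 17212 — no purchase, every stub
carries `0 < k` —, K3 Serre anchor) — nothing of these shapes.
-/

set_option linter.dupNamespace false

noncomputable section

namespace Summit.Langlands.Langlands.Cruxes.SummandsPotentiallyAutomorphic.ResidualDichotomy

open Summit.Langlands.Langlands.Theses.OrdinaryPrimeTransport
open Filter
open scoped NumberField

/-! ## 1. The five stubs -/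

/-- **STUB 1 — summand inheritance at an ordinary prime** (verbatim `Birth.stub_summand_inherits`): in the
crux's situation the irreducible exact summand `σ` is (a) unramified at all but finitely many places,
(b) crystalline-ordinary at every `v ∣ ℓ₀`, (c) de Rham at every `v ∣ ℓ₀` for the pinned Fontaine datum.
Why true: Satake uniqueness + Chebotarev + Brauer–Nesbitt give `ρ₀^ss ≅ ρ₁^ss`; `σ` is a Jordan–Hölder
constituent of both; constituents inherit a.e.-unramifiedness, the induced ordinary sub-flag (exponents a
strictly decreasing subsequence) and de Rham-ness (AHTW Thm 1.2.1 for the avatars; subquotients).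
[cite: AHTW2026, Thm. 1.2.1] [cite: DeligneSerreASENS1974, Lemme 3.2] -/
theorem stub_summand_inherits :
    ∀ (K : Type) [Field K] [NumberField K], (NumberField.IsTotallyReal K ∨ NumberField.IsCMField K) → ∀ (p : ℕ) (hcpt : Literature.NumberTheory.Automorphic.isCompact_glFiniteIntegralLevel p K) (π : Literature.NumberTheory.Automorphic.CuspidalAutomorphicRepData p K hcpt), π.1.IsLAlgebraic → (∃ T : Literature.NumberTheory.Automorphic.InfinityType K p, π.1.HasInfinityType T ∧ T.IsRegular) → ∀ (ℓ₀ : ℕ) [Fact ℓ₀.Prime] (ι₀ : PadicAlgCl ℓ₀ ≃+* ℂ), (∃ ρ₁ : Literature.NumberTheory.GaloisRepresentations.FramedGaloisRep K (PadicAlgCl ℓ₀) p, (∀ᶠ v : IsDedekindDomain.HeightOneSpectrum (NumberField.RingOfIntegers K) in Filter.cofinite, Summit.Langlands.SatakeFrobCompatibleAt ι₀ π.1 ρ₁ v) ∧ ∀ v : IsDedekindDomain.HeightOneSpectrum (NumberField.RingOfIntegers K), ((ℓ₀ : ℕ) : NumberField.RingOfIntegers K) ∈ v.asIdeal → ρ₁.IsCrystallineOrdinaryAt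 ℓ₀ v) → ∀ (ρ₀ : Literature.NumberTheory.GaloisRepresentations.FramedGaloisRep K (PadicAlgCl ℓ₀) p), (∀ᶠ v : IsDedekindDomain.HeightOneSpectrum (NumberField.RingOfIntegers K) in Filter.cofinite, Summit.Langlands.SatakeFrobCompatibleAt ι₀ π.1 ρ₀ v) → ∀ (k : ℕ), 0 < k → k < p → ∀ (σ : Literature.NumberTheory.GaloisRepresentations.FramedGaloisRep K (PadicAlgCl ℓ₀) k) (τ : Literature.NumberTheory.GaloisRepresentations.FramedGaloisRep K (PadicAlgCl ℓ₀) (p - k)), σ.toGaloisRep.IsIrreducible → (∀ g : Field.absoluteGaloisGroup K, ρ₀.charpoly g = σ.charpoly g * τ.charpoly g) → (∀ᶠ v : IsDedekindDomain.HeightOneSpectrum (NumberField.RingOfIntegers K) in Filter.cofinite, σ.IsUnramifiedAt v) ∧ (∀ v : IsDedekindDomain.HeightOneSpectrum (NumberField.RingOfIntegers K), ((ℓ₀ : ℕ) : NumberField.RingOfIntegers K) ∈ v.asIdeal → σ.IsCrystallineOrdinaryAt ℓ₀ v) ∧ (∀ (v : IsDedekindDomain.HeightOneSpectrum (NumberField.RingOfIntegers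 K)) (hv : ((ℓ₀ : ℕ) : NumberField.RingOfIntegers K) ∈ v.asIdeal), (Literature.NumberTheory.PAdicHodge.fontainePstAdicCompletion v ℓ₀ hv).IsDeRhamFramed (σ.toLocal v)) := by
  sorry

/-- **STUB 2 — ordinary potential automorphy with field control, BIG-OR-ABELIAN sector** (citation-grade):
`K` totally real or CM, `k ≥ 1`, `σ : Γ_K → GL_k(ℚ̄_ℓ₀)` irreducible, a.e. unramified, crystalline-ordinary
and de Rham (pinned datum) above `ℓ₀`, and either `k = 1` or `σ` is Qian-good over some finite Galois CM
`K₁/K` (hypotheses (iii)–(iv) of `Qian2022.potentialAutomorphy_ordinary` verbatim for some residual `τ` of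
`σ|_{K₁}`) ⟹ a finite Galois CM `F'/K` with `σ|_{F'}` irreducible and `Qian2022.IsAutomorphic ι₀ (σ|_{F'})`.
Why true: `k = 1`: a de Rham (locally algebraic) a.e.-unramified `ℓ₀`-adic character is the avatar of an
algebraic Hecke character (class field theory, Weil; `F' :=` any CM quadratic / `K` itself).  `k ≥ 2`:
apply Qian Thm 1.4 over `K₁` to `r := σ|_{K₁}` with `K^{av} ⊇` the fixed field of `ker τ` (so the image of
`τ` does not shrink over `F'`, keeping `σ|_{F'}` residually absolutely irreducible, hence irreducible);
`IsOrdinaryRegularAt` from `IsCrystallineOrdinaryAt` at the canonical Artin datum (`ε ∘ Art = N⁻¹` on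
units); de Rham / a.e.-unramified / ordinary pass to `σ|_{K₁}`; `F'/K₁` Galois CM from the fact, and
`F'/K` Galois because Qian's `F' = K₁ · L̃` with `L̃/ℚ` Galois (held text pp. 21–24) and `K₁/K` Galois —
a proof-grade, not statement-grade, clause (the one delta on the vendored statement); finally
`(σ|_{K₁})|_{F'} ≃ σ|_{F'}` (`nonempty_equiv_restrictField_restrictField`).  Not the crux (no automorphic
origin, no descent, Qian-form conclusion) and not the summit.
[cite: Qian2022, Thm. 1.4] [cite: AllenCalegariCaraianiGeeEtAl2023, Thm. 6.1.2] -/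
theorem stub_potentiallyAutomorphic_big :
    ∀ (K : Type) [Field K] [NumberField K], (NumberField.IsTotallyReal K ∨ NumberField.IsCMField K) → ∀ (k : ℕ), 0 < k → ∀ (ℓ₀ : ℕ) [Fact ℓ₀.Prime] (ι₀ : PadicAlgCl ℓ₀ ≃+* ℂ) (σ : Literature.NumberTheory.GaloisRepresentations.FramedGaloisRep K (PadicAlgCl ℓ₀) k), σ.toGaloisRep.IsIrreducible → (∀ᶠ v : IsDedekindDomain.HeightOneSpectrum (NumberField.RingOfIntegers K) in Filter.cofinite, σ.IsUnramifiedAt v) → (∀ v : IsDedekindDomain.HeightOneSpectrum (NumberField.RingOfIntegers K), ((ℓ₀ : ℕ) : NumberField.RingOfIntegers K) ∈ v.asIdeal → σ.IsCrystallineOrdinaryAt ℓ₀ v) → (∀ (v : IsDedekindDomain.HeightOneSpectrum (NumberField.RingOfIntegers K)) (hv : ((ℓ₀ : ℕ) : NumberField.RingOfIntegers K) ∈ v.asIdeal), (Literature.NumberTheory.PAdicHodge.fontainePstAdicCompletion v ℓ₀ hv).IsDeRhamFramed (σ.toLocal v)) → (k = 1 ∨ ∃ (K₁ : Type) (_ :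 Field K₁) (_ : NumberField K₁) (_ : Algebra K K₁), IsGalois K K₁ ∧ NumberField.IsCMField K₁ ∧ ∃ τ : Field.absoluteGaloisGroup K₁ →* GL (Fin k) (Literature.NumberTheory.GaloisRepresentations.padicAlgClResidueField ℓ₀), (σ.restrictField K₁).IsResidualRepOf (RingHom.id _) τ ∧ Literature.NumberTheory.GaloisRepresentations.IsAbsIrreducible τ ∧ Literature.NumberTheory.GaloisRepresentations.IsDecomposedGeneric τ ∧ Literature.NumberTheory.GaloisRepresentations.IsAbsIrreducible (τ.comp (Literature.NumberTheory.GaloisRepresentations.absGaloisGroupAdjoinRootsOfUnity K₁ ℓ₀).subtype) ∧ Literature.NumberTheory.GaloisRepresentations.Subgroup.IsEnormous ((Literature.NumberTheory.GaloisRepresentations.absGaloisGroupAdjoinRootsOfUnity K₁ ℓ₀).map τ) ∧ ∃ g : Field.absoluteGaloisGroup K₁, g ∉ Literature.NumberTheory.GaloisRepresentations.absGaloisGroupAdjoinRootsOfUnity K₁ ℓ₀ ∧ ∃ c : Literature.NumberTheory.GaloisRepresentations.padicAlgClResidueField ℓ₀, ((τ g : GL (Fin k) (Literature.NumberTheory.GaloisRepresentations.padicAlgClResidueField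 ℓ₀)) : Matrix (Fin k) (Fin k) (Literature.NumberTheory.GaloisRepresentations.padicAlgClResidueField ℓ₀)) = c • (1 : Matrix (Fin k) (Fin k) (Literature.NumberTheory.GaloisRepresentations.padicAlgClResidueField ℓ₀))) → ∃ (F' : Type) (_ : Field F') (_ : NumberField F') (_ : Algebra K F') (_ : IsGalois K F'), NumberField.IsCMField F' ∧ (σ.restrictField F').toGaloisRep.IsIrreducible ∧ Literature.NumberTheory.Automorphic.Qian2022.IsAutomorphic ι₀ (σ.restrictField F') := by
  sorry

/-- **STUB 3 — THE OPEN CORE: the residually DEGENERATE sector**, typed sharply.  In the crux's situation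
(`K` TR/CM, `p` odd prime, `π` cuspidal L-algebraic regular on `GL_p(𝔸_K)`, an ordinary compatible avatar
`ρ₁` at `(ℓ₀, ι₀)`, a compatible avatar `ρ₀`, an irreducible exact framed summand `σ` of rank `0 < k < p`),
given moreover that `σ` is a.e. unramified, crystalline-ordinary and de Rham above `ℓ₀`, and that `σ` is
NEITHER a character NOR Qian-good over any finite Galois CM `K₁/K`: there is a finite Galois CM `F'/K` with
`σ|_{F'}` irreducible and Qian-automorphic.  Why plausibly true: TRUE under the summit (Fontaine–Mazur–
Langlands for the geometric regular `σ`, then cyclic base change to a CM quadratic `F'` disjoint from the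
monodromy field).  Why OPEN: every engine in print ends in an automorphy lifting theorem at `ℓ₀` whose
Taylor–Wiles step needs `σ̄|_{K(ζ)}` adequate (Miagkov–Thorne 2023 Thm 1.3; ⇐ absolutely irreducible for
`ℓ₀ > 2(k+1)`, Guralnick–Herzig–Tiep) — the residually reducible non-polarised case over CM fields
(Skinner–Wiles in positive defect) has no theorem (Thorne 2015 / Allen–Newton–Thorne 2020 are polarised;
Berger–Klosin is `GL_2` over imaginary quadratic fields under a cyclicity hypothesis; Pan 2022 is `GL_2/ℚ`).
The automorphic origin is KEPT in the binders on purpose (a future Eisenstein-ideal / `P`-ordinary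
argument may use that `σ ⊕ τ` is the semisimplified avatar of a CUSPIDAL `π`).  Not the crux (extra
hypotheses, Qian-form conclusion) and not the summit.
[cite: MiagkovThorne2023, Thm. 1.3] [cite: Thorne2015JAMS, Thm. 1.1] -/
theorem stub_potentiallyAutomorphic_degenerate :
    ∀ (K : Type) [Field K] [NumberField K], (NumberField.IsTotallyReal K ∨ NumberField.IsCMField K) → ∀ (p : ℕ), Nat.Prime p → 3 ≤ p → ∀ (hcpt : Literature.NumberTheory.Automorphic.isCompact_glFiniteIntegralLevel p K) (π : Literature.NumberTheory.Automorphic.CuspidalAutomorphicRepData p K hcpt), π.1.IsLAlgebraic → (∃ T : Literature.NumberTheory.Automorphic.InfinityType K p, π.1.HasInfinityType T ∧ T.IsRegular) → ∀ (ℓ₀ : ℕ) [Fact ℓ₀.Prime] (ι₀ : PadicAlgCl ℓ₀ ≃+* ℂ), (∃ ρ₁ : Literature.NumberTheory.GaloisRepresentations.FramedGaloisRep K (PadicAlgCl ℓ₀) p, (∀ᶠ v : IsDedekindDomain.HeightOneSpectrum (NumberField.RingOfIntegers K) in Filter.cofinite, Summit.Langlands.SatakeFrobCompatibleAt ι₀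 π.1 ρ₁ v) ∧ ∀ v : IsDedekindDomain.HeightOneSpectrum (NumberField.RingOfIntegers K), ((ℓ₀ : ℕ) : NumberField.RingOfIntegers K) ∈ v.asIdeal → ρ₁.IsCrystallineOrdinaryAt ℓ₀ v) → ∀ (ρ₀ : Literature.NumberTheory.GaloisRepresentations.FramedGaloisRep K (PadicAlgCl ℓ₀) p), (∀ᶠ v : IsDedekindDomain.HeightOneSpectrum (NumberField.RingOfIntegers K) in Filter.cofinite, Summit.Langlands.SatakeFrobCompatibleAt ι₀ π.1 ρ₀ v) → ∀ (k : ℕ), 0 < k → k < p → ∀ (σ : Literature.NumberTheory.GaloisRepresentations.FramedGaloisRep K (PadicAlgCl ℓ₀) k) (τ : Literature.NumberTheory.GaloisRepresentations.FramedGaloisRep K (PadicAlgCl ℓ₀) (p - k)), σ.toGaloisRep.IsIrreducible → (∀ g : Field.absoluteGaloisGroup K, ρ₀.charpoly g = σ.charpoly g * τ.charpoly g) → (∀ᶠ v : IsDedekindDomain.HeightOneSpectrum (NumberField.RingOfIntegers K) in Filter.cofinite, σ.IsUnramifiedAt v) → (∀ v : IsDedekindDomain.HeightOneSpectrum (NumberField.RingOfIntegers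 K), ((ℓ₀ : ℕ) : NumberField.RingOfIntegers K) ∈ v.asIdeal → σ.IsCrystallineOrdinaryAt ℓ₀ v) → (∀ (v : IsDedekindDomain.HeightOneSpectrum (NumberField.RingOfIntegers K)) (hv : ((ℓ₀ : ℕ) : NumberField.RingOfIntegers K) ∈ v.asIdeal), (Literature.NumberTheory.PAdicHodge.fontainePstAdicCompletion v ℓ₀ hv).IsDeRhamFramed (σ.toLocal v)) → ¬ (k = 1 ∨ ∃ (K₁ : Type) (_ : Field K₁) (_ : NumberField K₁) (_ : Algebra K K₁), IsGalois K K₁ ∧ NumberField.IsCMField K₁ ∧ ∃ τ : Field.absoluteGaloisGroup K₁ →* GL (Fin k) (Literature.NumberTheory.GaloisRepresentations.padicAlgClResidueField ℓ₀), (σ.restrictField K₁).IsResidualRepOf (RingHom.id _) τ ∧ Literature.NumberTheory.GaloisRepresentations.IsAbsIrreducible τ ∧ Literature.NumberTheory.GaloisRepresentations.IsDecomposedGeneric τ ∧ Literature.NumberTheory.GaloisRepresentations.IsAbsIrreducible (τ.comp (Literature.NumberTheory.GaloisRepresentations.absGaloisGroupAdjoinRootsOfUnity K₁ ℓ₀).subtype)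 ∧ Literature.NumberTheory.GaloisRepresentations.Subgroup.IsEnormous ((Literature.NumberTheory.GaloisRepresentations.absGaloisGroupAdjoinRootsOfUnity K₁ ℓ₀).map τ) ∧ ∃ g : Field.absoluteGaloisGroup K₁, g ∉ Literature.NumberTheory.GaloisRepresentations.absGaloisGroupAdjoinRootsOfUnity K₁ ℓ₀ ∧ ∃ c : Literature.NumberTheory.GaloisRepresentations.padicAlgClResidueField ℓ₀, ((τ g : GL (Fin k) (Literature.NumberTheory.GaloisRepresentations.padicAlgClResidueField ℓ₀)) : Matrix (Fin k) (Fin k) (Literature.NumberTheory.GaloisRepresentations.padicAlgClResidueField ℓ₀)) = c • (1 : Matrix (Fin k) (Fin k) (Literature.NumberTheory.GaloisRepresentations.padicAlgClResidueField ℓ₀))) → ∃ (F' : Type) (_ : Field F') (_ : NumberField F') (_ : Algebra K F') (_ : IsGalois K F'), NumberField.IsCMField F' ∧ (σ.restrictField F').toGaloisRep.IsIrreducible ∧ Literature.NumberTheory.Automorphic.Qian2022.IsAutomorphic ι₀ (σ.restrictField F') := by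
  sorry

/-- **STUB 4 — soluble descent of automorphy to every intermediate field** (verbatim `Birth.stub_solubleDescent_intermediate`;
`k ≥ 2` is the named fact `ACC2023.solubleDescent_isAutomorphic` = ACC+ Prop 6.5.13 (2) plus glue, `k = 1` is class field
theory): for any number field `K`, `k ≥ 1`, `σ : Γ_K → GL_k(ℚ̄_ℓ₀)` and a finite Galois CM extension `F'/K` such that `σ|_{Γ_{F'}}`
is irreducible and Qian-automorphic, and every intermediate field `K ⊆ E ⊆ F'` with `Gal(F'/E)` soluble, `σ|_{Γ_E}` is
Qian-automorphic.  Glue: intermediate fields of a CM Galois extension are totally real or CM; `F'/E` is Galois;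
`(σ|_E)|_{F'} ≃ σ|_{F'}` up to a change of frame (`nonempty_equiv_restrictField_restrictField`).
[cite: AllenCalegariCaraianiGeeEtAl2023, Prop. 6.5.13 (2)] [cite: ArthurClozelAMS120, Ch. 3 Thm. 4.2 and 5.1] -/
theorem stub_solubleDescent_intermediate :
    ∀ (K : Type) [Field K] [NumberField K] (k : ℕ), 0 < k →
      ∀ (ℓ₀ : ℕ) [Fact ℓ₀.Prime] (ι₀ : PadicAlgCl ℓ₀ ≃+* ℂ)
        (σ : Literature.NumberTheory.GaloisRepresentations.FramedGaloisRep K (PadicAlgCl ℓ₀) k)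
        (F' : Type) [Field F'] [NumberField F'] [Algebra K F'] [IsGalois K F'],
        NumberField.IsCMField F' → (σ.restrictField F').toGaloisRep.IsIrreducible →
        Literature.NumberTheory.Automorphic.Qian2022.IsAutomorphic ι₀ (σ.restrictField F') →
      ∀ (E : Type) [Field E] [NumberField E] [Algebra K E] [Algebra E F'] [IsScalarTower K E F'],
        IsSolvable (F' ≃ₐ[E] F') →
          Literature.NumberTheory.Automorphic.Qian2022.IsAutomorphic ι₀ (σ.restrictField E) := by
  sorry

/-- **STUB 5 — renormalisation: Qian-automorphic ⇒ Satake–Frobenius compatible with some cuspidal `P` a.e.** (verbatim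
`Birth.stub_satakeCompatible_of_isAutomorphic`): for any number field `E`, `k ≥ 1`, `ℓ`, `ι` and `r : Γ_E → GL_k(ℚ̄_ℓ)` with
`Qian2022.IsAutomorphic ι r`, there is a cuspidal `P` on `GL_k(𝔸_E)` — `P := Π ⊗ |det|^{(1-k)/2}` — such that `r` is
Satake–Frobenius compatible with `P` in the summit's untwisted normalisation at all but finitely many `w`
(`arithFrobPolyOfSatake ι q 1 (q^{(k-1)/2} α) = arithFrobPolyOfSatake ι q k α`; exceptional set finite by
`AutomorphicRepData.isUnramifiedAbove_cofinite`). [cite: BuzzardGeeLMS2014, §2.1 and Conj. 3.2.1] [cite: HarrisLanTaylorThorneRMS2016, Thm. A] -/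
theorem stub_satakeCompatible_of_isAutomorphic :
    ∀ (E : Type) [Field E] [NumberField E] (k : ℕ), 0 < k →
      ∀ (ℓ : ℕ) [Fact ℓ.Prime] (ι : PadicAlgCl ℓ ≃+* ℂ)
        (r : Literature.NumberTheory.GaloisRepresentations.FramedGaloisRep E (PadicAlgCl ℓ) k),
        Literature.NumberTheory.Automorphic.Qian2022.IsAutomorphic ι r →
        ∃ (hE : Literature.NumberTheory.Automorphic.isCompact_glFiniteIntegralLevel k E)
          (P : Literature.NumberTheory.Automorphic.CuspidalAutomorphicRepData k E hE),
          ∀ᶠ w : IsDedekindDomain.HeightOneSpectrum (𝓞 E) in cofinite,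
            Summit.Langlands.SatakeFrobCompatibleAt ι P.1 r w := by
  sorry

/-! ## 2. The stub statements as named propositions -/

namespace _Goal

/-- The statement of `stub_summand_inherits`, as a named `Prop`. [folklore] -/
def stub_summand_inherits : Prop :=
  type_of% @Summit.Langlands.Langlands.Cruxes.SummandsPotentiallyAutomorphic.ResidualDichotomy.stub_summand_inherits

/-- The statement of `stub_potentiallyAutomorphic_big`, as a named `Prop`. [folklore] -/
def stub_potentiallyAutomorphic_big : Prop :=
  type_of% @Summit.Langlands.Langlands.Cruxes.SummandsPotentiallyAutomorphic.ResidualDichotomy.stub_potentiallyAutomorphic_big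

/-- The statement of `stub_potentiallyAutomorphic_degenerate`, as a named `Prop`. [folklore] -/
def stub_potentiallyAutomorphic_degenerate : Prop :=
  type_of% @Summit.Langlands.Langlands.Cruxes.SummandsPotentiallyAutomorphic.ResidualDichotomy.stub_potentiallyAutomorphic_degenerate

/-- The statement of `stub_solubleDescent_intermediate`, as a named `Prop`. [folklore] -/
def stub_solubleDescent_intermediate : Prop :=
  type_of% @Summit.Langlands.Langlands.Cruxes.SummandsPotentiallyAutomorphic.ResidualDichotomy.stub_solubleDescent_intermediate

/-- The statement of `stub_satakeCompatible_of_isAutomorphic`, as a named `Prop`. [folklore] -/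
def stub_satakeCompatible_of_isAutomorphic : Prop :=
  type_of% @Summit.Langlands.Langlands.Cruxes.SummandsPotentiallyAutomorphic.ResidualDichotomy.stub_satakeCompatible_of_isAutomorphic

end _Goal

/-! ## 3. The composition (kernel-checked, no `sorry`) -/

/-- **`SummandsPotentiallyAutomorphic` from the four stubs.**  STUB 1 makes the irreducible exact summand
`σ` a.e. unramified, crystalline-ordinary and de Rham above `ℓ₀`; according as `σ` is a character or
Qian-good over some Galois CM `K₁/K` (STUB 2) or not (STUB 3) there is a finite Galois CM `F'/K` with
`σ|_{F'}` irreducible and Qian-automorphic; STUB 4 descends to each soluble-index intermediate `E` and STUB 5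
renormalises.  Conclusion: the route decl, by name. [folklore] -/
theorem SummandsPotentiallyAutomorphic_of (h₁ : _Goal.stub_summand_inherits)
    (h₂ : _Goal.stub_potentiallyAutomorphic_big) (h₃ : _Goal.stub_potentiallyAutomorphic_degenerate)
    (h₄ : _Goal.stub_solubleDescent_intermediate) (h₅ : _Goal.stub_satakeCompatible_of_isAutomorphic) :
    Summit.Langlands.Langlands.Theses.OrdinaryPrimeTransport.SummandsPotentiallyAutomorphic := by
  unfold _Goal.stub_summand_inherits at h₁
  unfold _Goal.stub_potentiallyAutomorphic_big at h₂
  unfold _Goal.stub_potentiallyAutomorphic_degenerate at h₃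
  unfold _Goal.stub_solubleDescent_intermediate at h₄
  unfold _Goal.stub_satakeCompatible_of_isAutomorphic at h₅
  intro K _ _ hK p hp h3 hcpt π hL hreg ℓ₀ _ ι₀ hord ρ₀ hρ₀ k hk hkp σ τ hσ hchar
  -- STUB 1: inheritance
  obtain ⟨hunr, hordσ, hdRσ⟩ := h₁ K hK p hcpt π hL hreg ℓ₀ ι₀ hord ρ₀ hρ₀ k hk hkp σ τ hσ hchar
  -- STUBS 2 / 3: potential automorphy over a Galois CM `F'`, by residual type
  have hPA : ∃ (F' : Type) (_ : Field F') (_ : NumberField F') (_ : Algebra K F') (_ : IsGalois K F'),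
      NumberField.IsCMField F' ∧ (σ.restrictField F').toGaloisRep.IsIrreducible ∧
        Literature.NumberTheory.Automorphic.Qian2022.IsAutomorphic ι₀ (σ.restrictField F') := by
    by_cases hbig : (k = 1 ∨ ∃ (K₁ : Type) (_ : Field K₁) (_ : NumberField K₁) (_ : Algebra K K₁), IsGalois K K₁ ∧ NumberField.IsCMField K₁ ∧ ∃ τ : Field.absoluteGaloisGroup K₁ →* GL (Fin k) (Literature.NumberTheory.GaloisRepresentations.padicAlgClResidueField ℓ₀), (σ.restrictField K₁).IsResidualRepOf (RingHom.id _) τ ∧ Literature.NumberTheory.GaloisRepresentations.IsAbsIrreducible τ ∧ Literature.NumberTheory.GaloisRepresentations.IsDecomposedGeneric τ ∧ Literature.NumberTheory.GaloisRepresentations.IsAbsIrreducible (τ.comp (Literature.NumberTheory.GaloisRepresentations.absGaloisGroupAdjoinRootsOfUnity K₁ ℓ₀).subtype) ∧ Literature.NumberTheory.GaloisRepresentations.Subgroup.IsEnormous ((Literature.NumberTheory.GaloisRepresentations.absGaloisGroupAdjoinRootsOfUnity K₁ ℓ₀).map τ) ∧ ∃ g : Field.absoluteGaloisGroup K₁,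 g ∉ Literature.NumberTheory.GaloisRepresentations.absGaloisGroupAdjoinRootsOfUnity K₁ ℓ₀ ∧ ∃ c : Literature.NumberTheory.GaloisRepresentations.padicAlgClResidueField ℓ₀, ((τ g : GL (Fin k) (Literature.NumberTheory.GaloisRepresentations.padicAlgClResidueField ℓ₀)) : Matrix (Fin k) (Fin k) (Literature.NumberTheory.GaloisRepresentations.padicAlgClResidueField ℓ₀)) = c • (1 : Matrix (Fin k) (Fin k) (Literature.NumberTheory.GaloisRepresentations.padicAlgClResidueField ℓ₀)))
    · exact h₂ K hK k hk ℓ₀ ι₀ σ hσ hunr hordσ hdRσ hbig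
    · exact h₃ K hK p hp h3 hcpt π hL hreg ℓ₀ ι₀ hord ρ₀ hρ₀ k hk hkp σ τ hσ hchar hunr hordσ hdRσ hbig
  obtain ⟨F', _, _, _, _, hCM, hirr', haut'⟩ := hPA
  refine ⟨F', inferInstance, inferInstance, inferInstance, inferInstance, hCM, hirr', ?_⟩
  intro E _ _ _ _ _ hsolv
  -- STUB 4: soluble descent to the intermediate field `E`
  have hautE := h₄ K k hk ℓ₀ ι₀ σ F' hCM hirr' haut' E hsolv
  -- STUB 5: renormalise to the summit's Satake–Frobenius clause
  exact h₅ E k hk ℓ₀ ι₀ (σ.restrictField E) hautE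

/-- By-name sanity check: the five stubs feed the composition as they stand. -/
example : Summit.Langlands.Langlands.Theses.OrdinaryPrimeTransport.SummandsPotentiallyAutomorphic :=
  SummandsPotentiallyAutomorphic_of stub_summand_inherits stub_potentiallyAutomorphic_big
    stub_potentiallyAutomorphic_degenerate stub_solubleDescent_intermediate stub_satakeCompatible_of_isAutomorphic

end Summit.Langlands.Langlands.Cruxes.SummandsPotentiallyAutomorphic.ResidualDichotomy

end
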